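import Literature.NumberTheory.LocalFields.UnramifiedQuadraticNormQuadraticCount
import HarnessLib

/-!
# Anti-fixed classes divisible by `𝔪^k` and the pair count of Flicker's Prop. 13, cases (b)∕(d) — FILE 6 of the story `UnramifiedQuadraticNorm*`
(Flicker (1998), *Elementary proof of the fundamental lemma for a unitary group*, Prop. 13 pp. 91–93, cases (b) and (d); Serre, *Local Fields*, V §2)

Topic `NumberTheory/LocalFields`, namespace `Literature.NumberTheory.LocalFields.UnramifiedQuadraticNorm` (FILE 1 ★ `…FixedPoints`, FILE 2 ★ `…Fibres`, FILE 4 ★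
`…Congruences` (A-p03), FILE 5 ★ `…QuadraticCount` (A-p03)).  THEOREMS ONLY: no definition, no named fact, no instance, no notation, no `sorry`; kernel lane.  Cell
`pub/hodgecm-mathlib`, road «D-N7-inert» ∕ MAP v3 «N7-ns COUNT FROM FLICKER», brick «PROP. 13 (X1) = (13-ii) COUNT-0» FILE J1 (LEAD F0P3a-plan (g9) T8-70 (C); pen
F0P3b-p01 (g6) under A-p03 (g24) pen 1; census `F0/P3/F0P3b-p01/g6/CENSUS-F8-Prop13-CountZero-X1.F0P3bp01g6.md`).  HC_CM is proved only modulo the 2 remaining named inputs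
(hLiu418, h413) until rung 0 closes; this file is elementary finite counting and proves no letter.

SETTING (as FILE 4∕5): `R` a complete discrete valuation ring with finite residue field, `|R ⧸ 𝔪| = q²`; `σ` a ring involution of `R` with an antisymmetric unit
`σ a − a ∈ Rˣ` (the unramified quadratic situation `R = R_E ⊃ R^σ = R_F`); `σ̄_m` the induced involution of `R ⧸ 𝔪^m`; `φ : R ⧸ 𝔪^m → R ⧸ 𝔪^k` the reduction.
* §1 **`natCard_antifixed_factor_eq_zero`** — `#{x ∈ R ⧸ 𝔪^m : σ̄x = −x, x ≡ 0 (mod 𝔪^k)} = q^{m−k}` (`k ≤ m`): multiplication by the antisymmetric unit `σa − a` carries the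
  `σ̄`-FIXED classes reducing to `0` (★ `natCard_fixed_fibre_factor` at `y = 0`) bijectively onto the anti-fixed ones (Flicker: «the number of the `λ` is `q^{m+[N∕2]}`»,
  p. 93, read as `λ ∈ π^{m−[N∕2]}R ∕ π^{2m}R`; here in the `ρ_m`-currency `x = λ√D mod 𝔪^m`, `x ∈ 𝔪^k`, `k = m − [N∕2]`).
* §2 **`natCard_pairs_norm_congr_antifixed_zero`** — THE PAIR COUNT OF PROP. 13 (b)∕(d): `#{(u, x) : uσ̄u ≡ r (mod 𝔪^k), σ̄x = −x, x ≡ 0 (mod 𝔪^k)} =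
  (q^{m−k}·q^{m−1}(q+1)) · q^{m−k}` for a `σ`-fixed unit `r` and `1 ≤ k ≤ m` (★ FILE 4 `natCard_norm_congr_quotient_pow` × §1) — with the `N₀`-fibre `q^m` of (F3c-β) and
  `k = m − [N∕2]` this is Flicker's `(1+q⁻¹)q^{2m+2[N∕2]}` (★ `iThirteen` (b)∕(d), ★ `natCast_count_b_eq`).
NOT here: the (c)∕(e) pair count (norm in a class of order `M − N`), the group-side junction (FILE J2 `UnitaryThreeBorelCosetCountJZero`).

## References
* [Flicker1998UnitaryFL] Y. Z. Flicker, *Elementary proof of the fundamental lemma for a unitary group*, Canad. J. Math. 50 (1998), 74–98: Prop. 13 pp. 91–93.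
* [Serre1979] J.-P. Serre, *Local Fields*, GTM 67 (1979), Ch. V §2 Prop. 2–3.
-/

set_option autoImplicit false

namespace Literature.NumberTheory.LocalFields.UnramifiedQuadraticNorm

open IsLocalRing

universe u

variable {R : Type u} [CommRing R] (σ : R →+* R)

section Count

variable [IsDomain R] [IsDiscreteValuationRing R] [Finite (ResidueField R)] [IsAdicComplete (maximalIdeal R) R]
  (hσ : ∀ a, σ (σ a) = a) {a : R} (ha : IsUnit (σ a - a)) {q : ℕ} (hq : Nat.card (ResidueField R) = q ^ 2)

/-! ## §1 Anti-fixed classes divisible by `𝔪^k` -/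

omit [IsAdicComplete (maximalIdeal R) R] in
include ha hq in
/-- **`#{x ∈ R ⧸ 𝔪^m : σ̄_m x = −x, x ≡ 0 (mod 𝔪^k)} = q^{m−k}`** (`k ≤ m`): multiplication by the antisymmetric unit `e = σa − a` (`σ̄ē = −ē`) is a bijection from the
`σ̄_m`-fixed classes reducing to `0` modulo `𝔪^k` (★ `natCard_fixed_fibre_factor`, `q^{m−k}` of them) onto the anti-fixed ones. [cite: Flicker1998UnitaryFL, Prop. 13 p. 93]
[cite: Serre1979, Ch. V §2 Prop. 2–3] -/
theorem natCard_antifixed_factor_eq_zero {k m : ℕ} (hkm : k ≤ m) :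
    Nat.card {x : R ⧸ maximalIdeal R ^ m // Ideal.quotientMap (maximalIdeal R ^ m) σ (maximalIdeal_pow_le_comap σ hσ m) x = -x ∧
      Ideal.Quotient.factor (Ideal.pow_le_pow_right hkm) x = 0} = q ^ (m - k) := by
  set σm := Ideal.quotientMap (maximalIdeal R ^ m) σ (maximalIdeal_pow_le_comap σ hσ m) with hσm
  set φ := Ideal.Quotient.factor (S := maximalIdeal R ^ m) (T := maximalIdeal R ^ k) (Ideal.pow_le_pow_right hkm) with hφ
  -- the antisymmetric unit `ē` of `R ⧸ 𝔪^m`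
  have heu : IsUnit (Ideal.Quotient.mk (maximalIdeal R ^ m) (σ a - a)) := ha.map _
  obtain ⟨e, he⟩ := heu
  have hσe : σm (e : R ⧸ maximalIdeal R ^ m) = -e := by
    rw [he, hσm, quotientMap_mk σ hσ m, map_sub, hσ, ← map_neg, neg_sub]
  have hσeinv : σm (↑e⁻¹ : R ⧸ maximalIdeal R ^ m) = -↑e⁻¹ := by
    have h1 : σm (e : R ⧸ maximalIdeal R ^ m) * σm (↑e⁻¹ : R ⧸ maximalIdeal R ^ m) = 1 := by rw [← map_mul, Units.mul_inv, map_one]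
    rw [hσe, neg_mul, neg_eq_iff_eq_neg] at h1
    calc σm (↑e⁻¹ : R ⧸ maximalIdeal R ^ m) = ↑e⁻¹ * ((e : R ⧸ maximalIdeal R ^ m) * σm ↑e⁻¹) := by rw [← mul_assoc, Units.inv_mul, one_mul]
      _ = -↑e⁻¹ := by rw [h1, mul_neg, mul_one]
  have hfix := natCard_fixed_fibre_factor σ hσ ha hq hkm (0 : R ⧸ maximalIdeal R ^ k) (map_zero _)
  rw [← hfix]
  symm
  refine Nat.card_congr
    { toFun := fun x => ⟨(e : R ⧸ maximalIdeal R ^ m) * x.1, ?_, ?_⟩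
      invFun := fun x => ⟨(↑e⁻¹ : R ⧸ maximalIdeal R ^ m) * x.1, ?_, ?_⟩
      left_inv := fun x => Subtype.ext (by simp only [← mul_assoc, Units.inv_mul, one_mul])
      right_inv := fun x => Subtype.ext (by simp only [← mul_assoc, Units.mul_inv, one_mul]) }
  · rw [map_mul, hσe, x.2.1, neg_mul]
  · rw [map_mul, x.2.2, mul_zero]
  · rw [map_mul, hσeinv, x.2.1, neg_mul_neg]
  · rw [map_mul, x.2.2, mul_zero]

/-! ## §2 The pair count of Prop. 13 (b)∕(d) -/

include ha hq in
/-- **THE PAIR COUNT OF PROP. 13, CASES (b)∕(d)**: for `1 ≤ k ≤ m` and a `σ`-fixed unit `r`,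
`#{(u, x) ∈ (R ⧸ 𝔪^m)² : u σ̄u ≡ r (mod 𝔪^k), σ̄x = −x, x ≡ 0 (mod 𝔪^k)} = (q^{m−k} · q^{m−1}(q+1)) · q^{m−k}` — Flicker p. 93: «we need to count the `Δ = (uū)⁻¹ ∈ −x + π^{k}R`
and `λ ∈ π^{k}R ∕ π^{2m}R` … `#{u ∈ R_E^× ∕ 1 + π^mR_E ; uū ∈ 1 + π^{k}R}` is `(1 + q⁻¹)q^{m+[N∕2]}`, while the number of the `λ` is `q^{m+[N∕2]}`» (`k = m − [N∕2]`), in the `ρ_m`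
currency of (F3c-β) (`x mod 𝔪^m`; the remaining factor `q^m` is the `N₀`-fibre).  Product of ★ `natCard_norm_congr_quotient_pow` and §1.
[cite: Flicker1998UnitaryFL, Prop. 13 p. 93] [cite: Serre1979, Ch. V §2 Prop. 3 and Corollary] -/
theorem natCard_pairs_norm_congr_antifixed_zero {k m : ℕ} (hk : 1 ≤ k) (hkm : k ≤ m) {r : R} (hr : IsUnit r) (hσr : σ r = r) :
    Nat.card {p : (R ⧸ maximalIdeal R ^ m) × (R ⧸ maximalIdeal R ^ m) //
      Ideal.Quotient.factor (Ideal.pow_le_pow_right hkm) (p.1 * Ideal.quotientMap (maximalIdeal R ^ m) σ (maximalIdeal_pow_le_comap σ hσ m) p.1) =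
          Ideal.Quotient.mk (maximalIdeal R ^ k) r ∧
        Ideal.quotientMap (maximalIdeal R ^ m) σ (maximalIdeal_pow_le_comap σ hσ m) p.2 = -p.2 ∧
        Ideal.Quotient.factor (Ideal.pow_le_pow_right hkm) p.2 = 0} =
      (q ^ (m - k) * (q ^ (m - 1) * (q + 1))) * q ^ (m - k) := by
  rw [← natCard_norm_congr_quotient_pow σ hσ ha hq hk hkm hr hσr, ← natCard_antifixed_factor_eq_zero σ hσ ha hq hkm, ← Nat.card_prod]
  refine Nat.card_congr
    { toFun := fun p => (⟨p.1.1, p.2.1⟩, ⟨p.1.2, p.2.2.1, p.2.2.2⟩)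
      invFun := fun p => ⟨(p.1.1, p.2.1), p.1.2, p.2.2.1, p.2.2.2⟩
      left_inv := fun p => rfl
      right_inv := fun p => rfl }

end Count

end Literature.NumberTheory.LocalFields.UnramifiedQuadraticNorm
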